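import Literature.AlgebraicGeometry.Motives.UniversalHyperplaneSectionSmoothNear
import HarnessLib

/-!
# The universal hyperplane section of a geometrically irreducible `X` is geometrically irreducible

Topic `Literature/AlgebraicGeometry/Motives` (theorems only; no definitions, no named facts).
For a closed (more generally affine) immersion `ι : X ⟶ ℙᴺ_k`, `N ≥ 2`, of an INTEGRAL `k`-scheme
`X` which is geometrically irreducible over `k`, the universal hyperplane section
`𝒳 = {(x, a) | Σᵢ aᵢ xᵢ(x) = 0} ⊂ X × (ℙᴺ)^*` (`Motives/UniversalHyperplaneSection`) is
**geometrically irreducible over `k`** (`geometricallyIrreducible_hom`): "the incidence variety is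
a `ℙᴺ⁻¹`-bundle over `X`" (Voisin II §2.1.1), hence irreducible when `X` is, over every field
extension.

Proof. After base change to a field `K ⊇ k`, `𝒳_K` is covered by the base changes of the open
pieces `𝒳 ∩ (X'_j × D₊(a_l))`, `X'_j = ι⁻¹D₊(x_j)`, `j ≠ l`, each the graph
`Spec Γ(X, X'_j)[aᵢ/a_l : i ≠ j, l] = 𝔸ᴺ⁻¹_{X'_j}` (`exists_modelIso`); `𝔸ᴺ⁻¹_{X'_j} → X'_j` is
geometrically irreducible and universally open (Mathlib, affine space), so its base change over the
irreducible `(X'_j)_K ⊆ X_K` has irreducible source (Stacks 0366, Mathlib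
`GeometricallyIrreducible`). Two pieces meet: the generic point of the piece `(j, l)` lies over
the generic point of `X` (so in every `X'_{j'}`) and in `D₊(a_{l'})` for every `l' ≠ j` (its dual
coordinates `a_{l'}/a_l`, `l' ≠ j`, are free variables of the model); with `N ≥ 2` any two pieces
are linked through a third, and a space covered by open irreducible pieces so linked is
irreducible (Hartshorne I Ex. 1.6).

## References

* [VoisinHodgeII2003] C. Voisin, Hodge Theory and Complex Algebraic Geometry II, CUP 2003, §2.1.1, §3.2.2.
* [StacksProject] The Stacks Project, Tag 0366 (geometrically irreducible schemes), Tag 037O.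
* [Hartshorne1977] R. Hartshorne, Algebraic Geometry, I Ex. 1.6, II Ex. 3.15.
-/

noncomputable section

open CategoryTheory AlgebraicGeometry Limits MonoidalCategory CartesianMonoidalCategory
  HomogeneousLocalization TensorProduct

universe u

namespace Literature.AlgebraicGeometry.Motives.UniversalHyperplaneSection

/-! ### Topology: irreducibility from linked irreducible open pieces -/

/-- In an irreducible open piece meeting another open piece, the first lies in the closure of the
second (a nonempty open subset of an irreducible set is dense in it). [cite: Hartshorne1977, I Ex. 1.6] -/
theorem subset_closure_of_inter_nonempty {α : Type*} [TopologicalSpace α] {U V : Set α}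
    (hU : IsIrreducible U) (hV : IsOpen V) (h : (U ∩ V).Nonempty) : U ⊆ closure V :=
  (subset_closure_inter_of_isPreirreducible_of_isOpen hU.isPreirreducible hV h).trans
    (closure_mono Set.inter_subset_right)

/-- **Irreducibility from linked open irreducible pieces**: a space covered by open sets `U i`, each
empty or irreducible, one of which, `U i₀ ≠ ∅`, is linked to every nonempty `U i` through a piece
meeting both, is irreducible (every nonempty piece lies in `closure (U i₀)`, which is then the whole
space and irreducible). [cite: Hartshorne1977, I Examples 1.1.3–1.1.4 and Ex. 1.6] -/
theorem irreducibleSpace_of_iUnion_eq_univ_of_linked {α ι : Type*} [TopologicalSpace α]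
    (U : ι → Set α) (hU : ⋃ i, U i = Set.univ) (ho : ∀ i, IsOpen (U i))
    (hirr : ∀ i, (U i).Nonempty → IsIrreducible (U i)) (i₀ : ι) (h₀ : (U i₀).Nonempty)
    (hlink : ∀ i, (U i).Nonempty → ∃ i', (U i ∩ U i').Nonempty ∧ (U i' ∩ U i₀).Nonempty) :
    IrreducibleSpace α := by
  have hdense : closure (U i₀) = Set.univ := by
    refine Set.eq_univ_of_univ_subset ?_
    rw [← hU]
    refine Set.iUnion_subset fun i ↦ ?_
    rcases (U i).eq_empty_or_nonempty with hi | hi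
    · rw [hi]
      exact Set.empty_subset _
    obtain ⟨i', h1, h2⟩ := hlink i hi
    have hi' : (U i').Nonempty := ⟨_, h2.some_mem.1⟩
    have s1 : U i ⊆ closure (U i') := subset_closure_of_inter_nonempty (hirr i hi) (ho i') h1
    have s2 : U i' ⊆ closure (U i₀) := subset_closure_of_inter_nonempty (hirr i' hi') (ho i₀) h2
    exact s1.trans ((closure_mono s2).trans_eq isClosed_closure.closure_eq)
  have := isIrreducible_iff_closure.mpr (hirr i₀ h₀)
  rw [hdense] at this
  exact (irreducibleSpace_def α).mpr this

/-! ### `Spec A[y] → Spec A` is geometrically irreducible and universally open -/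

/-- `Spec A[yᵢ | i ∈ σ] → Spec A` is geometrically irreducible (Mathlib's instance for affine space
`𝔸(σ; S) → S`, transported along `𝔸(σ; Spec A) ≅ Spec A[σ]` and a reindexing to lower the
universe of `σ`). [cite: StacksProject, Tag 0366] -/
theorem geometricallyIrreducible_SpecMap_algebraMap_mvPolynomial (A : Type u) [CommRing A]
    (σ : Type) :
    GeometricallyIrreducible (Spec.map (CommRingCat.ofHom (algebraMap A (MvPolynomial σ A)))) := by
  have h𝔸 : GeometricallyIrreducible
      (Spec.map (CommRingCat.ofHom (MvPolynomial.C : A →+* MvPolynomial (ULift.{u} σ) A))) := by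
    rw [← AffineSpace.SpecIso_inv_over (n := ULift.{u} σ) (.of A)]
    infer_instance
  let ε : CommRingCat.of (MvPolynomial (ULift.{u} σ) A) ≅ .of (MvPolynomial σ A) :=
    (MvPolynomial.renameEquiv A Equiv.ulift).toRingEquiv.toCommRingCatIso
  have hC : CommRingCat.ofHom (algebraMap A (MvPolynomial σ A)) =
      CommRingCat.ofHom (MvPolynomial.C : A →+* MvPolynomial (ULift.{u} σ) A) ≫ ε.hom := by
    ext r : 2
    exact (MvPolynomial.rename_C _ r).symm
  rw [hC, Spec.map_comp]
  exact (MorphismProperty.cancel_left_of_respectsIso @GeometricallyIrreducible _ _).mpr h𝔸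

/-- `Spec A[yᵢ | i ∈ σ] → Spec A` is smooth (the tautological submersive presentation), hence flat,
locally of finite presentation and universally open. [cite: Hartshorne1977, III §10 Example 10.0.1] -/
theorem universallyOpen_SpecMap_algebraMap_mvPolynomial (A : Type u) [CommRing A] (σ : Type)
    [Finite σ] :
    UniversallyOpen (Spec.map (CommRingCat.ofHom (algebraMap A (MvPolynomial σ A)))) := by
  classical
  let P₀ : Algebra.PreSubmersivePresentation A (MvPolynomial σ A) σ PEmpty.{1} :=
    { toGenerators := Algebra.Generators.mvPolynomial A σ
      relation := PEmpty.elim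
      span_range_relation_eq_ker := by
        rw [Set.range_eq_empty, Ideal.span_empty, Algebra.Generators.ker_mvPolynomial]
      map := PEmpty.elim
      map_inj := fun a ↦ a.elim }
  let P : Algebra.SubmersivePresentation A (MvPolynomial σ A) σ PEmpty.{1} :=
    { __ := P₀
      jacobian_isUnit := by
        rw [Algebra.PreSubmersivePresentation.jacobian_eq_jacobiMatrix_det, Matrix.det_isEmpty,
          map_one]
        exact isUnit_one }
  have hst : Algebra.IsStandardSmoothOfRelativeDimension (Nat.card σ) A (MvPolynomial σ A) :=
    P.isStandardSmoothOfRelativeDimension (by simp [Algebra.Presentation.dimension])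
  have hsm : SmoothOfRelativeDimension (Nat.card σ)
      (Spec.map (CommRingCat.ofHom (algebraMap A (MvPolynomial σ A)))) := by
    refine (HasRingHomProperty.Spec_iff (P := @SmoothOfRelativeDimension (Nat.card σ))).mpr ?_
    rw [CommRingCat.hom_ofHom]
    refine RingHom.locally_of RingHom.isStandardSmoothOfRelativeDimension_respectsIso _ ?_
    exact (RingHom.isStandardSmoothOfRelativeDimension_algebraMap (Nat.card σ)).mpr hst
  haveI : Smooth (Spec.map (CommRingCat.ofHom (algebraMap A (MvPolynomial σ A)))) :=
    SmoothOfRelativeDimension.smooth (Nat.card σ) _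
  infer_instance

/-! ### The pieces of the universal hyperplane section -/

section Pieces

variable {k : Type u} [Field k] {N : ℕ} {X : SchemeOver k} (ι : X ⟶ projectiveSpace N k)

/-- **The pieces of `𝒳`.** For `j ≠ l`, with `X' = ι⁻¹D₊(x_j)` (affine, `ι` being affine), there
is an open immersion `u : M ↪ 𝒳` (the piece `𝒳 ∩ (X' × D₊(a_l)) ≅ Spec Γ(X, X')[aᵢ/a_l : i ≠ j, l]`)
such that: (range) its image is `{z | j(z) ∈ X', π(z) ∈ D₊(a_l)}`; (irreducibility) for every field
`K ⊇ k` the base change of `M → Spec k` is irreducible as soon as it is nonempty, provided `X` is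
geometrically irreducible (it is the base change of `𝔸ᴺ⁻¹_{X'} → X'`, geometrically irreducible and
universally open, over the irreducible open `(X')_K ⊆ X_K`); (generic point) if `X' ≠ ∅` and `X` is
integral, the image `z` of the generic point of `M` lies over the generic point of `X` (so in every
nonempty open of `X`) and in `D₊(a_{l'})` for every `l' ≠ j` (the functions `a_{l'}/a_l`, `l' ≠ j, l`,
are free variables of the model, and `a_l/a_l = 1`). [cite: VoisinHodgeII2003, §2.1.1]
[cite: StacksProject, Tag 0366] -/
theorem exists_piece [IsIntegral X.left] [IsAffineHom ι.left] [GeometricallyIrreducible X.hom]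
    (j l : Fin (N + 1)) (hjl : j ≠ l) :
    letI := MvPolynomial.gradedAlgebra (σ := Fin (N + 1)) (R := k)
    ∃ (M : Scheme.{u}) (u : M ⟶ (universalHyperplaneSection N ι).left), IsOpenImmersion u ∧
      Set.range u = {z | (toX N ι).left z ∈ ι.left ⁻¹ᵁ Proj.basicOpen (Segre.grading (Fin (N + 1)) k)
          (MvPolynomial.X j) ∧
        (proj N ι).left z ∈ Proj.basicOpen (Segre.grading (Fin (N + 1)) k) (MvPolynomial.X l)} ∧
      (∀ (K : Type u) [Field K] [Algebra k K],
        Nonempty ↥(pullback (u ≫ (universalHyperplaneSection N ι).hom)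
          (Spec.map (CommRingCat.ofHom (algebraMap k K)))) →
        IrreducibleSpace ↥(pullback (u ≫ (universalHyperplaneSection N ι).hom)
          (Spec.map (CommRingCat.ofHom (algebraMap k K))))) ∧
      ((∃ x : X.left, x ∈ ι.left ⁻¹ᵁ Proj.basicOpen (Segre.grading (Fin (N + 1)) k) (MvPolynomial.X j)) →
        ∃ z ∈ Set.range u,
          (∀ U : X.left.Opens, (U : Set X.left).Nonempty → (toX N ι).left z ∈ U) ∧
          (∀ l' : Fin (N + 1), l' ≠ j →
            (proj N ι).left z ∈ Proj.basicOpen (Segre.grading (Fin (N + 1)) k) (MvPolynomial.X l'))) := by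
  classical
  letI := MvPolynomial.gradedAlgebra (σ := Fin (N + 1)) (R := k)
  letI : ∀ l : Fin (N + 1), Algebra k (chartBaseRing (k := k) N l) := chartBaseRingAlgebra
  letI : ∀ U : X.left.Opens, Algebra k Γ(X.left, U) := sectionsAlgebra X
  -- the chart `X' × D₊(a_l)`, `X' = ι⁻¹D₊(x_j)` affine, `j = l.succAbove m₀`
  obtain ⟨m₀, hm₀⟩ : ∃ m₀ : Fin N, l.succAbove m₀ = j := Fin.exists_succAbove_eq hjl
  have hinst : IsAffineHom ι.left := inferInstance
  let X' : X.left.affineOpens := ⟨ι.left ⁻¹ᵁ Proj.basicOpen (Segre.grading (Fin (N + 1)) k) (MvPolynomial.X j),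
    @IsAffineOpen.preimage _ _ _
      (ProjSubscheme.affineBasicOpen (Segre.grading (Fin (N + 1)) k) (MvPolynomial.X j)
        (Segre.X_mem k j) zero_lt_one).2 ι.left hinst⟩
  have hX' : (X' : X.left.Opens) ≤ ι.left ⁻¹ᵁ Proj.basicOpen (Segre.grading (Fin (N + 1)) k)
    (MvPolynomial.X j) := le_rfl
  let A : Type u := Γ(X.left, (X' : X.left.Opens))
  let Mdl : Type u := HyperplaneSectionChart.Model A m₀
  obtain ⟨e, he⟩ := exists_modelIso ι j l X' m₀ hX' hm₀
  let u' : Spec (.of Mdl) ⟶ (universalHyperplaneSection N ι).left := e.hom ≫ chartSectionToSection ι l X'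
  haveI : IsOpenImmersion u' := inferInstance
  -- (range) `range u' = emb⁻¹(range chartImm)`
  have hrange : Set.range u' = {z | (toX N ι).left z ∈ (X' : X.left.Opens) ∧
      (proj N ι).left z ∈ Proj.basicOpen (Segre.grading (Fin (N + 1)) k) (MvPolynomial.X l)} := by
    have h1 : Set.range u' = Set.range (chartSectionToSection ι l X') := by
      apply le_antisymm
      · rintro _ ⟨y, rfl⟩
        exact ⟨e.hom y, rfl⟩
      · rintro _ ⟨y, rfl⟩
        exact ⟨e.inv y, by
          change (e.inv ≫ e.hom ≫ chartSectionToSection ι l X') y = _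
          rw [Iso.inv_hom_id_assoc]⟩
    have h2 : Set.range (chartSectionToSection ι l X') =
        (emb N ι).left ⁻¹' Set.range (chartImm X l X') :=
      Scheme.Pullback.range_fst _ _
    rw [h1, h2]
    erw [range_chartImm]
    rfl
  -- `u' ≫ j = Spec (A → Mdl) ≫ (X' ↪ X)` and `u' ≫ π = modelImm ≫ chartβ ≫ (D₊(a_l) ↪ (ℙᴺ)^*)`
  have huX : u' ≫ (toX N ι).left =
      Spec.map (CommRingCat.ofHom (algebraMap A Mdl)) ≫ X'.2.fromSpec := by
    calc u' ≫ (toX N ι).left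
        = e.hom ≫ chartSectionToSection ι l X' ≫ (emb N ι).left ≫
            pullback.fst X.hom (dualProjectiveSpace N k).hom := by
          change (e.hom ≫ chartSectionToSection ι l X') ≫ (toX N ι).left = _
          rw [Category.assoc]; rfl
      _ = e.hom ≫ chartSectionι ι l X' ≫ chartImm X l X' ≫
            pullback.fst X.hom (dualProjectiveSpace N k).hom := by
          rw [chartSectionToSection_emb_assoc]
          exact congrArg (e.hom ≫ ·) (Category.assoc _ _ _)
      _ = modelImm ι j l X' m₀ hX' ≫ Spec.map (CommRingCat.ofHom (algebraMap A (chartRing l X'))) ≫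
            X'.2.fromSpec := by
          rw [chartImm_fst, ← he, Category.assoc]
      _ = Spec.map (CommRingCat.ofHom (algebraMap A Mdl)) ≫ X'.2.fromSpec := by
          rw [modelImm, ← Spec.map_comp_assoc, ← CommRingCat.ofHom_comp]
          congr 3
          exact (modelHom ι j l X' m₀ hX').comp_algebraMap
  have huP : u' ≫ (proj N ι).left = modelImm ι j l X' m₀ hX' ≫ chartβ l X' ≫ chartBaseι N l := by
    calc u' ≫ (proj N ι).left
        = e.hom ≫ chartSectionToSection ι l X' ≫ (emb N ι).left ≫
            pullback.snd X.hom (dualProjectiveSpace N k).hom := by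
          change (e.hom ≫ chartSectionToSection ι l X') ≫ (proj N ι).left = _
          rw [Category.assoc]; rfl
      _ = e.hom ≫ chartSectionι ι l X' ≫ chartImm X l X' ≫
            pullback.snd X.hom (dualProjectiveSpace N k).hom := by
          rw [chartSectionToSection_emb_assoc]
          exact congrArg (e.hom ≫ ·) (Category.assoc _ _ _)
      _ = modelImm ι j l X' m₀ hX' ≫ chartβ l X' ≫ chartBaseι N l := by
          rw [chartImm_snd, ← he, Category.assoc]
  refine ⟨_, u', inferInstance, hrange, ?_, ?_⟩
  · -- (irreducibility of the base changes)
    intro K _ _ hne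
    set g : Spec (.of K) ⟶ Spec (.of k) := Spec.map (CommRingCat.ofHom (algebraMap k K)) with hgdef
    set a : Spec (.of Mdl) ⟶ Spec (.of A) := Spec.map (CommRingCat.ofHom (algebraMap A Mdl)) with hadef
    set b : Spec (.of A) ⟶ Spec (.of k) := X'.2.fromSpec ≫ X.hom with hbdef
    have hq : u' ≫ (universalHyperplaneSection N ι).hom = a ≫ b := by
      rw [← Over.w (toX N ι), ← Category.assoc, huX, Category.assoc]
    haveI : GeometricallyIrreducible a := geometricallyIrreducible_SpecMap_algebraMap_mvPolynomial A _
    haveI : UniversallyOpen a := universallyOpen_SpecMap_algebraMap_mvPolynomial A _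
    -- `X_K` is irreducible, hence so is its open piece `(X')_K = Spec A ×_k Spec K` once nonempty
    haveI : IrreducibleSpace ↥(pullback X.hom g) :=
      (geometrically_iff_of_commRing_of_isClosedUnderIsomorphisms (P := (IrreducibleSpace ·))).mp
        (GeometricallyIrreducible.geometrically_irreducibleSpace (f := X.hom)) K
    let ob : pullback b g ⟶ pullback X.hom g :=
      pullback.map b g X.hom g X'.2.fromSpec (𝟙 _) (𝟙 _) (by rw [Category.comp_id]) (by simp)
    haveI : IsOpenImmersion ob := Scheme.pullback_map_isOpenImmersion _ _ _ _ _ _ _ _ _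
    -- a point of the base change of the piece gives a point of `(X')_K`
    rw [hq] at hne ⊢
    obtain ⟨w⟩ := hne
    haveI : Nonempty ↥(pullback b g) :=
      ⟨(pullback.map (a ≫ b) g b g a (𝟙 _) (𝟙 _) (by rw [Category.comp_id]) (by simp)) w⟩
    haveI : IrreducibleSpace ↥(pullback b g) := ob.isOpenEmbedding.irreducibleSpace
    -- `M ×_k K = Spec Mdl ×_{Spec A} (Spec A ×_k K)`
    haveI : IrreducibleSpace ↥(pullback a (pullback.fst b g)) := inferInstance
    exact (pullbackRightPullbackFstIso b g a).hom.homeomorph.irreducibleSpace_iff.mp inferInstance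
  · -- (the generic point of the piece)
    rintro ⟨x₁, hx₁⟩
    haveI : Nonempty ((X' : X.left.Opens) : Type u) := ⟨⟨x₁, hx₁⟩⟩
    haveI : IsDomain A := IsIntegral.component_integral (X' : X.left.Opens)
    haveI : IsDomain Mdl := inferInstanceAs (IsDomain (MvPolynomial _ A))
    let η : Spec (.of Mdl) := ⟨⊥, Ideal.isPrime_bot⟩
    refine ⟨u' η, ⟨η, rfl⟩, ?_, ?_⟩
    · -- `j(u' η)` is the generic point of `X`
      intro U hU
      have hηX : (toX N ι).left (u' η) = X'.2.fromSpec ⟨⊥, Ideal.isPrime_bot⟩ := by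
        change (u' ≫ (toX N ι).left) η = _
        rw [huX, Scheme.Hom.comp_apply]
        congr 1
        apply PrimeSpectrum.ext
        rw [Spec.map_apply]
        change Ideal.comap (algebraMap A Mdl) ⊥ = ⊥
        exact Ideal.comap_bot_of_injective _ (MvPolynomial.C_injective _ _)
      -- its closure is everything: it contains `X' = fromSpec (closure {⊥})`, a dense open
      have hcl : closure {(toX N ι).left (u' η)} = Set.univ := by
        have h1 : (X' : Set X.left) ⊆ closure {(toX N ι).left (u' η)} := by
          rw [hηX, ← X'.2.range_fromSpec]
          rintro _ ⟨y, rfl⟩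
          have hy : y ∈ closure ({⟨⊥, Ideal.isPrime_bot⟩} : Set (PrimeSpectrum A)) := by
            rw [PrimeSpectrum.closure_singleton, PrimeSpectrum.zeroLocus_bot]
            exact Set.mem_univ _
          exact map_mem_closure X'.2.fromSpec.continuous hy (fun x hx ↦ by
            rw [Set.mem_singleton_iff.mp hx]; exact Set.mem_singleton _)
        have h2 : closure (X' : Set X.left) = Set.univ :=
          (X'.1.isOpen.dense ⟨x₁, hx₁⟩).closure_eq
        apply Set.eq_univ_of_univ_subset
        rw [← h2]
        exact closure_minimal h1 isClosed_closure
      by_contra hzU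
      have hsub : closure {(toX N ι).left (u' η)} ⊆ (U : Set X.left)ᶜ :=
        closure_minimal (Set.singleton_subset_iff.mpr hzU) U.isOpen.isClosed_compl
      rw [hcl, Set.univ_subset_iff, Set.compl_univ_iff] at hsub
      exact hU.ne_empty hsub
    · -- `π(u' η) ∈ D₊(a_{l'})` for `l' ≠ j`
      intro l' hl'
      have hηP : (proj N ι).left (u' η) =
          chartBaseι N l ((modelImm ι j l X' m₀ hX' ≫ chartβ l X') η) := by
        change (u' ≫ (proj N ι).left) η = _
        rw [huP, Scheme.Hom.comp_apply, Scheme.Hom.comp_apply, Scheme.Hom.comp_apply]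
      rw [hηP]
      refine (chartι_mem_basicOpen_iff _ l').mpr ?_
      -- the point is the contraction of `(0)`; `a_{l'}/a_l` maps to a non-zero element of the model
      have hpt : ((modelImm ι j l X' m₀ hX' ≫ chartβ l X') η).asIdeal =
          Ideal.comap ((modelHom ι j l X' m₀ hX').toRingHom.comp
            (RingHomClass.toRingHom (Algebra.TensorProduct.includeRight (R := k) (A := A)
              (B := chartBaseRing (k := k) N l)))) ⊥ := by
        rw [Scheme.Hom.comp_apply, modelImm, chartβ, Spec.map_apply, Spec.map_apply]
        rfl
      rw [hpt, Ideal.mem_comap, Ideal.mem_bot, RingHom.comp_apply]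
      change modelHom ι j l X' m₀ hX' ((1 : A) ⊗ₜ[k] Segre.frac k l l') ≠ 0
      rw [modelHom_includeRight]
      rcases eq_or_ne l' l with rfl | hll
      · rw [chartBaseEquiv_frac_self, map_one]
        exact one_ne_zero
      · obtain ⟨m, rfl⟩ : ∃ m : Fin N, l.succAbove m = l' := Fin.exists_succAbove_eq hll
        have hm : m ≠ m₀ := by
          rintro rfl
          exact hl' hm₀
        rw [chartBaseEquiv_frac_succAbove, MvPolynomial.aeval_X, HyperplaneSectionChart.subst_of_ne _ _ _ _ hm]
        exact MvPolynomial.X_ne_zero _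


/-! ### Geometric irreducibility -/

/-- **The universal hyperplane section of a geometrically irreducible integral `X ↪ ℙᴺ`, `N ≥ 2`,
is geometrically irreducible over `k`** (a `ℙᴺ⁻¹`-bundle over `X`; module docstring for the proof
by linked irreducible pieces after base change). [cite: VoisinHodgeII2003, §2.1.1 and §3.2.2]
[cite: StacksProject, Tag 0366] [cite: Hartshorne1977, II Ex. 3.15] -/
theorem geometricallyIrreducible_hom [IsIntegral X.left] [IsAffineHom ι.left]
    [GeometricallyIrreducible X.hom] (hN : 2 ≤ N) :
    GeometricallyIrreducible (universalHyperplaneSection N ι).hom := by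
  classical
  letI := MvPolynomial.gradedAlgebra (σ := Fin (N + 1)) (R := k)
  -- the pieces, indexed by the pairs `j ≠ l`
  choose M u hu hrange hirr hgen using
    fun p : {p : Fin (N + 1) × Fin (N + 1) // p.1 ≠ p.2} ↦ exists_piece ι p.1.1 p.1.2 p.2
  rw [geometricallyIrreducible_iff, geometrically_iff_of_commRing_of_isClosedUnderIsomorphisms]
  intro K _ _
  set q := (universalHyperplaneSection N ι).hom with hqdef
  set g : Spec (.of K) ⟶ Spec (.of k) := Spec.map (CommRingCat.ofHom (algebraMap k K)) with hgdef
  -- they cover `𝒳`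
  haveI : ∀ p, IsOpenImmersion (u p) := hu
  let 𝒰 : (universalHyperplaneSection N ι).left.OpenCover :=
    Scheme.Cover.mkOfCovers {p : Fin (N + 1) × Fin (N + 1) // p.1 ≠ p.2} M u (fun x ↦ by
      obtain ⟨j, l, hjl, hj, hl⟩ := exists_chart_indices N ι x
      have hx : x ∈ Set.range (u ⟨(j, l), hjl⟩) := by
        rw [hrange]
        exact ⟨hj, hl⟩
      obtain ⟨y, hy⟩ := hx
      exact ⟨⟨(j, l), hjl⟩, y, hy⟩)
  -- the base-changed cover of `𝒳_K`
  let 𝒱 := Scheme.Pullback.openCoverOfLeft 𝒰 q g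
  let U : {p : Fin (N + 1) × Fin (N + 1) // p.1 ≠ p.2} → Set ↥(pullback q g) :=
    fun p ↦ Set.range (𝒱.f p)
  have hU : ∀ p, U p = pullback.fst q g ⁻¹' Set.range (u p) := by
    intro p
    change Set.range ⇑(pullback.map (u p ≫ q) g q g (u p) (𝟙 _) (𝟙 _) (by simp) (by simp)) = _
    rw [Scheme.Pullback.range_map]
    ext w
    simp
  -- points of `𝒳_K` over points of `𝒳`
  have hpt : ∀ z : (universalHyperplaneSection N ι).left, ∃ w : ↥(pullback q g),
      pullback.fst q g w = z := fun z ↦ by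
    obtain ⟨w, hw, -⟩ := Scheme.Pullback.exists_preimage_pullback (f := q) (g := g) z default
      (Subsingleton.elim _ _)
    exact ⟨w, hw⟩
  have hmeet : ∀ p p' (z : (universalHyperplaneSection N ι).left),
      z ∈ Set.range (u p) → z ∈ Set.range (u p') → (U p ∩ U p').Nonempty := by
    intro p p' z hz hz'
    obtain ⟨w, hw⟩ := hpt z
    refine ⟨w, ?_, ?_⟩
    · rw [hU, Set.mem_preimage, hw]; exact hz
    · rw [hU, Set.mem_preimage, hw]; exact hz'
  -- a nonempty piece has `X'_j ≠ ∅`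
  have hne_of : ∀ p, (U p).Nonempty → ∃ x : X.left,
      x ∈ ι.left ⁻¹ᵁ Proj.basicOpen (Segre.grading (Fin (N + 1)) k) (MvPolynomial.X p.1.1) := by
    rintro p ⟨w, hw⟩
    rw [hU, Set.mem_preimage, hrange] at hw
    exact ⟨_, hw.1⟩
  -- the generic point of a nonempty piece `p` lies in every piece `p'` with `X'_{j'} ≠ ∅` and `l' ≠ j`
  have hgen' : ∀ p p', (U p).Nonempty → (U p').Nonempty → p'.1.2 ≠ p.1.1 →
      (U p ∩ U p').Nonempty := by
    intro p p' hp hp' hl'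
    obtain ⟨z, hz, hzX, hzP⟩ := hgen p (hne_of p hp)
    refine hmeet p p' z hz ?_
    rw [hrange]
    obtain ⟨x', hx'⟩ := hne_of p' hp'
    exact ⟨hzX _ ⟨x', hx'⟩, hzP _ hl'⟩
  -- the base piece `i₀ = (j₀, l₀)`: `X'_{j₀} ∋ x₀`
  obtain ⟨x₀⟩ : Nonempty X.left := inferInstance
  obtain ⟨j₀, hj₀⟩ := exists_mem_basicOpen_X (ι.left x₀)
  let l₀ : Fin (N + 1) := j₀.succAbove ⟨0, by omega⟩
  let l₁ : Fin (N + 1) := j₀.succAbove ⟨1, by omega⟩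
  have hl₀ : j₀ ≠ l₀ := (Fin.succAbove_ne j₀ _).symm
  have hl₁ : j₀ ≠ l₁ := (Fin.succAbove_ne j₀ _).symm
  have hl₀₁ : l₀ ≠ l₁ := fun h ↦ by
    have := Fin.succAbove_right_injective h
    simp [Fin.ext_iff] at this
  let i₀ : {p : Fin (N + 1) × Fin (N + 1) // p.1 ≠ p.2} := ⟨(j₀, l₀), hl₀⟩
  let i₁ : {p : Fin (N + 1) × Fin (N + 1) // p.1 ≠ p.2} := ⟨(j₀, l₁), hl₁⟩
  have hx₀ : x₀ ∈ ι.left ⁻¹ᵁ Proj.basicOpen (Segre.grading (Fin (N + 1)) k) (MvPolynomial.X j₀) := hj₀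
  have hU₀ : ∀ i : {p : Fin (N + 1) × Fin (N + 1) // p.1 ≠ p.2}, i.1.1 = j₀ → (U i).Nonempty := by
    rintro ⟨⟨j, l⟩, hjl⟩ rfl
    obtain ⟨z, hz, -, -⟩ := hgen ⟨(_, l), hjl⟩ ⟨x₀, hx₀⟩
    obtain ⟨w, hw1, -⟩ := hmeet _ _ z hz hz
    exact ⟨w, hw1⟩
  refine irreducibleSpace_of_iUnion_eq_univ_of_linked U 𝒱.iUnion_range
    (fun p ↦ (𝒱.f p).isOpenEmbedding.isOpen_range) (fun p hp ↦ ?_) i₀ (hU₀ i₀ rfl) (fun p hp ↦ ?_)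
  · -- nonempty pieces of `𝒳_K` are irreducible
    obtain ⟨_, ⟨w, rfl⟩⟩ := hp
    haveI : Nonempty ↥(pullback (u p ≫ q) g) := ⟨w⟩
    have hI : IrreducibleSpace ↥(pullback (u p ≫ q) g) := hirr p K inferInstance
    haveI : IrreducibleSpace ↥(𝒱.X p) := hI
    change IsIrreducible (Set.range _)
    rw [← Set.image_univ]
    exact (IrreducibleSpace.isIrreducible_univ _).image _ (𝒱.f p).continuous.continuousOn
  · -- every nonempty piece is linked to `i₀`
    by_cases h1 : l₀ = p.1.1
    swap
    · -- the generic point of `p` lies in `i₀`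
      exact ⟨p, ⟨hp.some, hp.some_mem, hp.some_mem⟩, hgen' p i₀ hp (hU₀ i₀ rfl) h1⟩
    by_cases h2 : p.1.2 = j₀
    swap
    · -- the generic point of `i₀` lies in `p`
      refine ⟨p, ⟨hp.some, hp.some_mem, hp.some_mem⟩, ?_⟩
      rw [Set.inter_comm]
      exact hgen' i₀ p (hU₀ i₀ rfl) hp h2
    · -- `p = (l₀, j₀)`: link through `i₁ = (j₀, l₁)`
      refine ⟨i₁, ?_, ?_⟩
      · exact hgen' p i₁ hp (hU₀ i₁ rfl) (by
          change l₁ ≠ p.1.1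
          rw [← h1]; exact hl₀₁.symm)
      · exact hgen' i₁ i₀ (hU₀ i₁ rfl) (hU₀ i₀ rfl) (by change l₀ ≠ j₀; exact hl₀.symm)

end Pieces

end Literature.AlgebraicGeometry.Motives.UniversalHyperplaneSection

end
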